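import Summits.BirchSwinnertonDyer.BirchSwinnertonDyer.Theorems.BiquadraticEisensteinDescentHeegnerTwistCouplingInSupplySymbolicMonskyAuxLowerBound
import HarnessLib

set_option linter.dupNamespace false -- `Summit.BirchSwinnertonDyer.BirchSwinnertonDyer.Theorems.…` (summit = sub)
set_option autoImplicit false

/-!
# Crux `HeegnerTwistCouplingInSupply` (stmt-BirchSwinnertonDyer-21381) — lower bounds for the number of auxiliary primes, the two other
# coordinate planes: the `(0, x)`- and `(x, 0)`-kernels of the base

Route `BiquadraticEisensteinDescent` (cell `pub/bsd-wall`, width seat `bsd-wall-cm-bed-w3` g21; `--supports` 21381, helper). Twin file of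
`…SymbolicMonskyAuxLowerBound` (★ `card_add_one_le_length_of_diagKernel`: the `(x,x)`-plane, `t ≥ κ_u + 1`).

With the same padding-by-zero of a base vector `x` on the auxiliary indices:
* `z = (0, x̄)` for `x` supported OFF the base primes `≡ ±3 (8)` and killed by the base Laplacian (`x ∈ ker L ∩ ker D_d`): `M z` vanishes on the
  base rows and on the half-one auxiliary rows, and equals `η′_q(x) := ∑_b [(P_b/q) = −1]·x_b` on the half-two auxiliary rows, with
  `∑_q η′_q(x) = 0` (Heegner: column parities AND «odd number of `q ≡ 3 (4)`», `prod_mod_four_eq` / `sum_bz_negNegOne_aux`) ⇒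
  ★ `card_add_one_le_length_of_inrKernel`: `t ≥ κ_w + 1`, `κ_w = dim(ker L ∩ ker D_d)`;
* `z = (x̄, 0)` for `x ∈ ker D_d ∩ ker(L + D_m)`: the image sits on the half-one auxiliary rows ⇒ ★ `card_add_one_le_length_of_inlKernel`:
  `t ≥ κ_v + 1`, `κ_v = dim(ker(L+D_m) ∩ ker D_d)`.
Example `length_ge_of_degenerate_base`: the «degenerate» base `p ≡ 7`, `r_i ≡ 1 (8)`, all symbols `+1` has `ker L ∩ ker D_d = 𝔽₂^{k+1}`, so every
winning Heegner recipe has `t ≥ k + 2` auxiliary primes (here `= t₀`; instance `k = 3`: `t ≥ 5`).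

Together with w3 g20's `t ≥ t₀ = s*/2 + 1` these are the four PROVED lower bounds `t ≥ max(t₀, κ_u+1, κ_w+1, κ_v+1)` of the w3 g21 memo
PATTERN-FREE-STRUCTURE (census: the minimal pattern-free `t` equals `max(t₀, κ_u+ε+1, κ_w+1, κ_v+1)` on all 2.1·10⁶ odd configurations `k ≤ 5`).
HONEST FRAMING: NECESSARY conditions only; RUNG-LEVEL corner layer; the crux (C⁺), its stubs and BSD untouched; nothing closed. THEOREMS ONLY.
Reference: [HeathBrown1994] appendix (Monsky), typescript pp. 39–41.
-/

namespace Summit.BirchSwinnertonDyer.BirchSwinnertonDyer.Theorems.SymbolicMonsky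

open Matrix

section AuxLowerBoundTwins

variable {k : ℕ} (base : SymbData (k + 1)) (aux : List AuxCell) (pat : ℕ → ℕ → Bool)

/-! ## §1 «Odd number of auxiliary primes ≡ 3 (mod 4)» from the Heegner check -/

/-- The product of odd classes mod `4` records the parity of the number of classes `≡ 3 (mod 4)`. -/
theorem prod_mod_four_eq (L : List AuxCell) :
    (L.map fun c => clsVal c.1).prod % 4 = if xorFold L (fun c => negNegOne c.1) then 3 else 1 := by
  induction L with
  | nil => simp [xorFold_nil]
  | cons a L ih =>
    rw [List.map_cons, List.prod_cons, xorFold_cons, Nat.mul_mod, ih]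
    have ha : ∀ c : Fin 4, clsVal c % 4 = if negNegOne c then 3 else 1 := by decide
    rw [ha a.1]
    cases negNegOne a.1 <;> cases xorFold L (fun c => negNegOne c.1) <;> decide

/-- Under the Heegner check the number of auxiliary cells of class `≡ 3 (mod 4)` is odd. -/
theorem xorFold_negNegOne_aux (hh : heegnerK base aux = true) : xorFold aux (fun c => negNegOne c.1) = true := by
  have h8 := (heegnerK_spec hh).2.1
  have h4 : (aux.map fun c => clsVal c.1).prod % 4 = 3 := by omega
  rw [prod_mod_four_eq] at h4
  by_contra hne
  rw [Bool.not_eq_true] at hne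
  rw [hne] at h4
  simp at h4

/-- In `𝔽₂`: `∑_j bz [q_j ≡ 3 (4)] = 1`. -/
theorem sum_bz_negNegOne_aux (hh : heegnerK base aux = true) :
    (∑ j : Fin aux.length, bz (negNegOne (aux.getD j.val (0, 0)).1)) = 1 := by
  rw [sum_univ_bz, xorFold_aux_eq aux (fun c => negNegOne c.1), xorFold_negNegOne_aux base aux hh]; rfl

/-- `∑_j η′_j(x) = 0` for EVERY base vector `x`, where `η′_j(x) = ∑_b bz[(P_b/q_j) = −1]·x_b` (cell bit XOR reciprocity). -/
theorem sum_eta'_eq_zero (hh : heegnerK base aux = true) (x : Fin (k + 1) → ZMod 2) :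
    (∑ j : Fin aux.length, ∑ b : Fin (k + 1),
        bz ((dataK base aux pat).neg (Fin.natAdd (k + 1) j) (Fin.castAdd aux.length b)) * x b) = 0 := by
  rw [Finset.sum_comm]
  refine Finset.sum_eq_zero fun b _ => ?_
  rw [← Finset.sum_mul]
  have step : (∑ j : Fin aux.length, bz ((dataK base aux pat).neg (Fin.natAdd (k + 1) j) (Fin.castAdd aux.length b))) =
      (∑ j : Fin aux.length, bz ((aux.getD j.val (0, 0)).2.testBit b.val)) +
        (∑ j : Fin aux.length, bz (negNegOne (aux.getD j.val (0, 0)).1)) * bz (negNegOne (base.cls b)) := by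
    rw [Finset.sum_mul, ← Finset.sum_add_distrib]
    refine Finset.sum_congr rfl fun j _ => ?_
    rw [dataK_neg_natAdd_castAdd, bz_xor_add, bz_and_mul]
  rw [step, sum_bz_cellBit_eq base aux hh b, sum_bz_negNegOne_aux base aux hh, one_mul, zmod_two_add_self, zero_mul]

/-- Class bookkeeping: `[(−1/P)=−1] + [(−2/P)=−1] = [(2/P)=−1]` in `𝔽₂`. -/
theorem bz_negNegOne_add_bz_negNegTwo (a : Fin 4) : bz (negNegOne a) + bz (negNegTwo a) = bz (negTwo a) := by
  fin_cases a <;> decide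

/-! ## §2 The `(0, x̄)` family -/

/-- Base rows, half one: `(M (0,x̄))_(inl b) = bz[(2/P_b)=−1]·x_b = 0` for `x ∈ ker D_d`. -/
theorem mulVec_padInr_inl_castAdd (x : Fin (k + 1) → ZMod 2) (hd : ∀ b, negTwo (base.cls b) = true → x b = 0) (b : Fin (k + 1)) :
    ((dataK base aux pat).monskyOddS *ᵥ Sum.elim (0 : Fin (k + 1 + aux.length) → ZMod 2)
        (Fin.append x (0 : Fin aux.length → ZMod 2))) (Sum.inl (Fin.castAdd aux.length b)) = 0 := by
  rw [SymbData.monskyOddS_mulVec_inl]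
  simp only [Sum.elim_inl, Sum.elim_inr, Pi.zero_apply, Fin.append_left, add_zero, mul_zero, Finset.sum_const_zero, zero_add,
    RealisesK.dataK_cls_castAdd]
  by_cases hb : negTwo (base.cls b) = true
  · rw [hd b hb, mul_zero]
  · have : negTwo (base.cls b) = false := by simpa using hb
    rw [this]; simp [bz]

/-- Base rows, half two: `(M (0,x̄))_(inr b) = 0` for `x ∈ ker L ∩ ker D_d`. -/
theorem mulVec_padInr_inr_castAdd (hh : heegnerK base aux = true) (x : Fin (k + 1) → ZMod 2)
    (hd : ∀ b, negTwo (base.cls b) = true → x b = 0)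
    (hL : ∀ b, (∑ b' : Fin (k + 1), bz (base.neg b b') * (x b' + x b)) = 0) (b : Fin (k + 1)) :
    ((dataK base aux pat).monskyOddS *ᵥ Sum.elim (0 : Fin (k + 1 + aux.length) → ZMod 2)
        (Fin.append x (0 : Fin aux.length → ZMod 2))) (Sum.inr (Fin.castAdd aux.length b)) = 0 := by
  rw [SymbData.monskyOddS_mulVec_inr]
  simp only [Sum.elim_inl, Sum.elim_inr, Pi.zero_apply, Fin.append_left, mul_zero, zero_add, RealisesK.dataK_cls_castAdd]
  rw [Fin.sum_univ_add]
  simp only [Fin.append_left, Fin.append_right, Pi.zero_apply, zero_add, dataK_neg_castAdd_castAdd, dataK_neg_castAdd_natAdd]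
  rw [hL b, zero_add, ← Finset.sum_mul, sum_bz_cellBit_eq base aux hh b]
  have key : bz (negNegOne (base.cls b)) * x b + bz (negNegTwo (base.cls b)) * x b = bz (negTwo (base.cls b)) * x b := by
    rw [← bz_negNegOne_add_bz_negNegTwo]; ring
  rw [key]
  by_cases hb : negTwo (base.cls b) = true
  · rw [hd b hb, mul_zero]
  · have : negTwo (base.cls b) = false := by simpa using hb
    rw [this]; simp [bz]

/-- Auxiliary rows, half one: `(M (0,x̄))_(inl q_j) = 0`. -/
theorem mulVec_padInr_inl_natAdd (x : Fin (k + 1) → ZMod 2) (j : Fin aux.length) :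
    ((dataK base aux pat).monskyOddS *ᵥ Sum.elim (0 : Fin (k + 1 + aux.length) → ZMod 2)
        (Fin.append x (0 : Fin aux.length → ZMod 2))) (Sum.inl (Fin.natAdd (k + 1) j)) = 0 := by
  rw [SymbData.monskyOddS_mulVec_inl]
  simp only [Sum.elim_inl, Sum.elim_inr, Pi.zero_apply, Fin.append_right, add_zero, mul_zero, Finset.sum_const_zero]

/-- Auxiliary rows, half two: `(M (0,x̄))_(inr q_j) = η′_j(x)`. -/
theorem mulVec_padInr_inr_natAdd (x : Fin (k + 1) → ZMod 2) (j : Fin aux.length) :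
    ((dataK base aux pat).monskyOddS *ᵥ Sum.elim (0 : Fin (k + 1 + aux.length) → ZMod 2)
        (Fin.append x (0 : Fin aux.length → ZMod 2))) (Sum.inr (Fin.natAdd (k + 1) j)) =
      ∑ b : Fin (k + 1), bz ((dataK base aux pat).neg (Fin.natAdd (k + 1) j) (Fin.castAdd aux.length b)) * x b := by
  rw [SymbData.monskyOddS_mulVec_inr]
  simp only [Sum.elim_inl, Sum.elim_inr, Pi.zero_apply, Fin.append_right, add_zero, mul_zero, zero_add]
  rw [Fin.sum_univ_add]
  simp only [Fin.append_left, Fin.append_right, Pi.zero_apply, mul_zero, Finset.sum_const_zero, add_zero]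

/-- ★ **LOWER BOUND, `(0,x)`-plane.** If the Heegner check holds and Monsky's odd matrix of `(base, aux, pat)` is invertible for some pattern,
every linearly independent family of base vectors supported off the primes `≡ ±3 (8)` and killed by the base Laplacian has fewer than `t`
members: `#ι + 1 ≤ t`, i.e. `t ≥ κ_w + 1`. [cite: HeathBrown1994SelmerCongruentII, Appendix (Monsky), typescript p. 39 L27–L33] -/
theorem card_add_one_le_length_of_inrKernel (hh : heegnerK base aux = true)
    (hdet : (dataK base aux pat).monskyOddS.det = 1) {ι : Type*} [Fintype ι] (x : ι → Fin (k + 1) → ZMod 2)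
    (hd : ∀ i b, negTwo (base.cls b) = true → x i b = 0)
    (hL : ∀ i b, (∑ b' : Fin (k + 1), bz (base.neg b b') * (x i b' + x i b)) = 0)
    (hx : LinearIndependent (ZMod 2) x) :
    Fintype.card ι + 1 ≤ aux.length := by
  classical
  set t := aux.length with ht
  set d := dataK base aux pat with hd'
  set Nm : Matrix (Fin t) (Fin (k + 1)) (ZMod 2) :=
    Matrix.of fun j b => bz (d.neg (Fin.natAdd (k + 1) j) (Fin.castAdd t b)) with hNm
  set η : (Fin (k + 1) → ZMod 2) →ₗ[ZMod 2] (Fin t → ZMod 2) := Matrix.mulVecLin Nm with hη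
  have hη_apply : ∀ (y : Fin (k + 1) → ZMod 2) (j : Fin t),
      η y j = ∑ b : Fin (k + 1), bz (d.neg (Fin.natAdd (k + 1) j) (Fin.castAdd t b)) * y b := by
    intro y j
    simp [hη, Matrix.mulVec, dotProduct, hNm]
  have hinj : ∀ y : Fin (k + 1) → ZMod 2, (∀ b, negTwo (base.cls b) = true → y b = 0) →
      (∀ b, (∑ b' : Fin (k + 1), bz (base.neg b b') * (y b' + y b)) = 0) → η y = 0 → y = 0 := by
    intro y hyd hyL hηy
    set z : Fin (k + 1 + t) ⊕ Fin (k + 1 + t) → ZMod 2 :=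
      Sum.elim (0 : Fin (k + 1 + t) → ZMod 2) (Fin.append y (0 : Fin t → ZMod 2)) with hz
    have hMz : d.monskyOddS *ᵥ z = 0 := by
      funext idx
      rcases idx with i | i
      · refine Fin.addCases (fun b => ?_) (fun j => ?_) i
        · exact mulVec_padInr_inl_castAdd base aux pat y hyd b
        · exact mulVec_padInr_inl_natAdd base aux pat y j
      · refine Fin.addCases (fun b => ?_) (fun j => ?_) i
        · exact mulVec_padInr_inr_castAdd base aux pat hh y hyd hyL b
        · rw [Pi.zero_apply, mulVec_padInr_inr_natAdd base aux pat y j, ← hη_apply y j, hηy, Pi.zero_apply]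
    have hz0 : z = 0 := by
      by_contra hne
      have : d.monskyOddS.det = 0 := Matrix.exists_mulVec_eq_zero_iff.mp ⟨z, hne, hMz⟩
      rw [hdet] at this
      exact one_ne_zero this
    funext b
    have := congrFun hz0 (Sum.inr (Fin.castAdd t b))
    simpa [hz] using this
  have hηx : LinearIndependent (ZMod 2) (fun i => η (x i)) := by
    rw [linearIndependent_iff'] at hx ⊢
    intro s g hg i hi
    have hsum : η (∑ i ∈ s, g i • x i) = 0 := by
      rw [map_sum]; simpa only [map_smul] using hg
    have hy : (∑ i ∈ s, g i • x i) = 0 := by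
      refine hinj _ (fun b hb => ?_) (fun b => ?_) hsum
      · simp [Finset.sum_apply, Pi.smul_apply, hd _ b hb]
      · have step1 : ∀ b' : Fin (k + 1), bz (base.neg b b') * ((∑ i ∈ s, g i • x i) b' + (∑ i ∈ s, g i • x i) b) =
            ∑ i ∈ s, g i * (bz (base.neg b b') * (x i b' + x i b)) := by
          intro b'
          simp only [Finset.sum_apply, Pi.smul_apply, smul_eq_mul]
          rw [← Finset.sum_add_distrib, Finset.mul_sum]
          exact Finset.sum_congr rfl fun i _ => by ring
        rw [Finset.sum_congr rfl fun b' _ => step1 b', Finset.sum_comm]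
        refine Finset.sum_eq_zero fun i _ => ?_
        rw [← Finset.mul_sum, hL i b, mul_zero]
    exact hx s g hy i hi
  set φ : (Fin t → ZMod 2) →ₗ[ZMod 2] ZMod 2 := ∑ j : Fin t, LinearMap.proj j with hφ
  have hφ_apply : ∀ v : Fin t → ZMod 2, φ v = ∑ j, v j := by
    intro v; simp [hφ, LinearMap.sum_apply]
  have hmem : ∀ i, η (x i) ∈ LinearMap.ker φ := by
    intro i
    rw [LinearMap.mem_ker, hφ_apply]
    simp only [hη_apply]
    exact sum_eta'_eq_zero base aux pat hh (x i)
  have hηx' : LinearIndependent (ZMod 2) (fun i => (⟨η (x i), hmem i⟩ : LinearMap.ker φ)) := by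
    apply LinearIndependent.of_comp (LinearMap.ker φ).subtype
    exact hηx
  have hcard := hηx'.fintype_card_le_finrank
  have ht0 : 0 < t := (heegnerK_spec hh).1
  have hlt : LinearMap.ker φ < ⊤ := by
    refine lt_top_iff_ne_top.mpr fun htop => ?_
    have hmem1 : (Pi.single (⟨0, ht0⟩ : Fin t) (1 : ZMod 2)) ∈ LinearMap.ker φ := by rw [htop]; exact Submodule.mem_top
    rw [LinearMap.mem_ker, hφ_apply] at hmem1
    simp at hmem1
  have hfin : Module.finrank (ZMod 2) (LinearMap.ker φ) < t := by
    have := Submodule.finrank_lt_finrank_of_lt hlt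
    simpa [Module.finrank_fintype_fun_eq_card] using this
  omega

/-! ## §3 The `(x̄, 0)` family -/

/-- Base rows, half one: `(M (x̄,0))_(inl b) = ((L + D_m)x)_b + bz[(2/P_b)=−1]·x_b = 0` for `x ∈ ker(L+D_m) ∩ ker D_d`. -/
theorem mulVec_padInl_inl_castAdd (hh : heegnerK base aux = true) (x : Fin (k + 1) → ZMod 2)
    (hd : ∀ b, negTwo (base.cls b) = true → x b = 0)
    (hLm : ∀ b, (∑ b' : Fin (k + 1), bz (base.neg b b') * (x b' + x b)) + bz (negNegOne (base.cls b)) * x b = 0) (b : Fin (k + 1)) :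
    ((dataK base aux pat).monskyOddS *ᵥ Sum.elim (Fin.append x (0 : Fin aux.length → ZMod 2))
        (0 : Fin (k + 1 + aux.length) → ZMod 2)) (Sum.inl (Fin.castAdd aux.length b)) = 0 := by
  rw [SymbData.monskyOddS_mulVec_inl]
  simp only [Sum.elim_inl, Sum.elim_inr, Pi.zero_apply, Fin.append_left, add_zero, RealisesK.dataK_cls_castAdd]
  rw [Fin.sum_univ_add]
  simp only [Fin.append_left, Fin.append_right, Pi.zero_apply, zero_add, dataK_neg_castAdd_castAdd, dataK_neg_castAdd_natAdd]
  rw [← Finset.sum_mul, sum_bz_cellBit_eq base aux hh b, hLm b, zero_add]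
  by_cases hb : negTwo (base.cls b) = true
  · rw [hd b hb, mul_zero]
  · have : negTwo (base.cls b) = false := by simpa using hb
    rw [this]; simp [bz]

/-- Base rows, half two: `(M (x̄,0))_(inr b) = bz[(2/P_b)=−1]·x_b = 0`. -/
theorem mulVec_padInl_inr_castAdd (x : Fin (k + 1) → ZMod 2) (hd : ∀ b, negTwo (base.cls b) = true → x b = 0) (b : Fin (k + 1)) :
    ((dataK base aux pat).monskyOddS *ᵥ Sum.elim (Fin.append x (0 : Fin aux.length → ZMod 2))
        (0 : Fin (k + 1 + aux.length) → ZMod 2)) (Sum.inr (Fin.castAdd aux.length b)) = 0 := by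
  rw [SymbData.monskyOddS_mulVec_inr]
  simp only [Sum.elim_inl, Sum.elim_inr, Pi.zero_apply, Fin.append_left, add_zero, mul_zero, Finset.sum_const_zero,
    RealisesK.dataK_cls_castAdd]
  by_cases hb : negTwo (base.cls b) = true
  · rw [hd b hb, mul_zero]
  · have : negTwo (base.cls b) = false := by simpa using hb
    rw [this]; simp [bz]

/-- Auxiliary rows, half one: `(M (x̄,0))_(inl q_j) = η′_j(x)`. -/
theorem mulVec_padInl_inl_natAdd (x : Fin (k + 1) → ZMod 2) (j : Fin aux.length) :
    ((dataK base aux pat).monskyOddS *ᵥ Sum.elim (Fin.append x (0 : Fin aux.length → ZMod 2))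
        (0 : Fin (k + 1 + aux.length) → ZMod 2)) (Sum.inl (Fin.natAdd (k + 1) j)) =
      ∑ b : Fin (k + 1), bz ((dataK base aux pat).neg (Fin.natAdd (k + 1) j) (Fin.castAdd aux.length b)) * x b := by
  rw [SymbData.monskyOddS_mulVec_inl]
  simp only [Sum.elim_inl, Sum.elim_inr, Pi.zero_apply, Fin.append_right, add_zero, mul_zero]
  rw [Fin.sum_univ_add]
  simp only [Fin.append_left, Fin.append_right, Pi.zero_apply, mul_zero, Finset.sum_const_zero, add_zero]

/-- Auxiliary rows, half two: `(M (x̄,0))_(inr q_j) = 0`. -/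
theorem mulVec_padInl_inr_natAdd (x : Fin (k + 1) → ZMod 2) (j : Fin aux.length) :
    ((dataK base aux pat).monskyOddS *ᵥ Sum.elim (Fin.append x (0 : Fin aux.length → ZMod 2))
        (0 : Fin (k + 1 + aux.length) → ZMod 2)) (Sum.inr (Fin.natAdd (k + 1) j)) = 0 := by
  rw [SymbData.monskyOddS_mulVec_inr]
  simp only [Sum.elim_inl, Sum.elim_inr, Pi.zero_apply, Fin.append_right, add_zero, mul_zero, Finset.sum_const_zero]

/-- ★ **LOWER BOUND, `(x,0)`-plane.** If the Heegner check holds and Monsky's odd matrix is invertible for some pattern, every linearly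
independent family of base vectors `x` supported off the primes `≡ ±3 (8)` with `(L + D_m)x = 0` has fewer than `t` members: `t ≥ κ_v + 1`.
[cite: HeathBrown1994SelmerCongruentII, Appendix (Monsky), typescript p. 39 L27–L33] -/
theorem card_add_one_le_length_of_inlKernel (hh : heegnerK base aux = true)
    (hdet : (dataK base aux pat).monskyOddS.det = 1) {ι : Type*} [Fintype ι] (x : ι → Fin (k + 1) → ZMod 2)
    (hd : ∀ i b, negTwo (base.cls b) = true → x i b = 0)
    (hLm : ∀ i b, (∑ b' : Fin (k + 1), bz (base.neg b b') * (x i b' + x i b)) + bz (negNegOne (base.cls b)) * x i b = 0)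
    (hx : LinearIndependent (ZMod 2) x) :
    Fintype.card ι + 1 ≤ aux.length := by
  classical
  set t := aux.length with ht
  set d := dataK base aux pat with hd'
  set Nm : Matrix (Fin t) (Fin (k + 1)) (ZMod 2) :=
    Matrix.of fun j b => bz (d.neg (Fin.natAdd (k + 1) j) (Fin.castAdd t b)) with hNm
  set η : (Fin (k + 1) → ZMod 2) →ₗ[ZMod 2] (Fin t → ZMod 2) := Matrix.mulVecLin Nm with hη
  have hη_apply : ∀ (y : Fin (k + 1) → ZMod 2) (j : Fin t),
      η y j = ∑ b : Fin (k + 1), bz (d.neg (Fin.natAdd (k + 1) j) (Fin.castAdd t b)) * y b := by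
    intro y j
    simp [hη, Matrix.mulVec, dotProduct, hNm]
  have hinj : ∀ y : Fin (k + 1) → ZMod 2, (∀ b, negTwo (base.cls b) = true → y b = 0) →
      (∀ b, (∑ b' : Fin (k + 1), bz (base.neg b b') * (y b' + y b)) + bz (negNegOne (base.cls b)) * y b = 0) → η y = 0 → y = 0 := by
    intro y hyd hyL hηy
    set z : Fin (k + 1 + t) ⊕ Fin (k + 1 + t) → ZMod 2 :=
      Sum.elim (Fin.append y (0 : Fin t → ZMod 2)) (0 : Fin (k + 1 + t) → ZMod 2) with hz
    have hMz : d.monskyOddS *ᵥ z = 0 := by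
      funext idx
      rcases idx with i | i
      · refine Fin.addCases (fun b => ?_) (fun j => ?_) i
        · exact mulVec_padInl_inl_castAdd base aux pat hh y hyd hyL b
        · rw [Pi.zero_apply, mulVec_padInl_inl_natAdd base aux pat y j, ← hη_apply y j, hηy, Pi.zero_apply]
      · refine Fin.addCases (fun b => ?_) (fun j => ?_) i
        · exact mulVec_padInl_inr_castAdd base aux pat y hyd b
        · exact mulVec_padInl_inr_natAdd base aux pat y j
    have hz0 : z = 0 := by
      by_contra hne
      have : d.monskyOddS.det = 0 := Matrix.exists_mulVec_eq_zero_iff.mp ⟨z, hne, hMz⟩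
      rw [hdet] at this
      exact one_ne_zero this
    funext b
    have := congrFun hz0 (Sum.inl (Fin.castAdd t b))
    simpa [hz] using this
  have hηx : LinearIndependent (ZMod 2) (fun i => η (x i)) := by
    rw [linearIndependent_iff'] at hx ⊢
    intro s g hg i hi
    have hsum : η (∑ i ∈ s, g i • x i) = 0 := by
      rw [map_sum]; simpa only [map_smul] using hg
    have hy : (∑ i ∈ s, g i • x i) = 0 := by
      refine hinj _ (fun b hb => ?_) (fun b => ?_) hsum
      · simp [Finset.sum_apply, Pi.smul_apply, hd _ b hb]
      · have step1 : ∀ b' : Fin (k + 1), bz (base.neg b b') * ((∑ i ∈ s, g i • x i) b' + (∑ i ∈ s, g i • x i) b) =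
            ∑ i ∈ s, g i * (bz (base.neg b b') * (x i b' + x i b)) := by
          intro b'
          simp only [Finset.sum_apply, Pi.smul_apply, smul_eq_mul]
          rw [← Finset.sum_add_distrib, Finset.mul_sum]
          exact Finset.sum_congr rfl fun i _ => by ring
        have step2 : bz (negNegOne (base.cls b)) * (∑ i ∈ s, g i • x i) b =
            ∑ i ∈ s, g i * (bz (negNegOne (base.cls b)) * x i b) := by
          simp only [Finset.sum_apply, Pi.smul_apply, smul_eq_mul, Finset.mul_sum]
          exact Finset.sum_congr rfl fun i _ => by ring
        rw [Finset.sum_congr rfl fun b' _ => step1 b', Finset.sum_comm, step2, ← Finset.sum_add_distrib]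
        refine Finset.sum_eq_zero fun i _ => ?_
        rw [← Finset.mul_sum, ← mul_add, hLm i b, mul_zero]
    exact hx s g hy i hi
  set φ : (Fin t → ZMod 2) →ₗ[ZMod 2] ZMod 2 := ∑ j : Fin t, LinearMap.proj j with hφ
  have hφ_apply : ∀ v : Fin t → ZMod 2, φ v = ∑ j, v j := by
    intro v; simp [hφ, LinearMap.sum_apply]
  have hmem : ∀ i, η (x i) ∈ LinearMap.ker φ := by
    intro i
    rw [LinearMap.mem_ker, hφ_apply]
    simp only [hη_apply]
    exact sum_eta'_eq_zero base aux pat hh (x i)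
  have hηx' : LinearIndependent (ZMod 2) (fun i => (⟨η (x i), hmem i⟩ : LinearMap.ker φ)) := by
    apply LinearIndependent.of_comp (LinearMap.ker φ).subtype
    exact hηx
  have hcard := hηx'.fintype_card_le_finrank
  have ht0 : 0 < t := (heegnerK_spec hh).1
  have hlt : LinearMap.ker φ < ⊤ := by
    refine lt_top_iff_ne_top.mpr fun htop => ?_
    have hmem1 : (Pi.single (⟨0, ht0⟩ : Fin t) (1 : ZMod 2)) ∈ LinearMap.ker φ := by rw [htop]; exact Submodule.mem_top
    rw [LinearMap.mem_ker, hφ_apply] at hmem1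
    simp at hmem1
  have hfin : Module.finrank (ZMod 2) (LinearMap.ker φ) < t := by
    have := Submodule.finrank_lt_finrank_of_lt hlt
    simpa [Module.finrank_fintype_fun_eq_card] using this
  omega

/-! ## §4 Example: the degenerate base needs `k + 2` auxiliary primes -/

/-- The «degenerate» base at `k = 3`: `p ≡ 7 (8)`, `r ≡ (1,1,1) (8)`, all symbols `+1`: the base Laplacian vanishes and no base prime is
`≡ ±3 (8)`, so `ker L ∩ ker D_d = 𝔽₂⁴` and every winning Heegner recipe has `t ≥ 5 = k + 2` (w3 g19/g20: the only configurations with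
`t₀ = k + 2`). -/
theorem five_le_length_of_degenerate (aux : List AuxCell) (pat : ℕ → ℕ → Bool)
    (hh : heegnerK (⟨![3, 0, 0, 0], fun _ _ => false⟩ : SymbData 4) aux = true)
    (hdet : (dataK (⟨![3, 0, 0, 0], fun _ _ => false⟩ : SymbData 4) aux pat).monskyOddS.det = 1) :
    5 ≤ aux.length := by
  have h := card_add_one_le_length_of_inrKernel (⟨![3, 0, 0, 0], fun _ _ => false⟩ : SymbData 4) aux pat hh hdet
    (![Pi.single 0 1, Pi.single 1 1, Pi.single 2 1, Pi.single 3 1] : Fin 4 → Fin 4 → ZMod 2) (by decide) (by decide)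
    (Fintype.linearIndependent_iff.mpr (by decide))
  simpa using h

end AuxLowerBoundTwins

end Summit.BirchSwinnertonDyer.BirchSwinnertonDyer.Theorems.SymbolicMonsky
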